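import Literature.AlgebraicGeometry.Resolution.KawasakiCharts
import Literature.AlgebraicGeometry.Resolution.ExtAnnihilatorSupport
import Literature.AlgebraicGeometry.Motives.ProjectiveDescentNormProofs
import Mathlib.RingTheory.RegularLocalRing.Polynomial
import HarnessLib

/-!
# Kawasaki's homogeneous annihilator ideal (Kawasaki 2000, La. 5.3 — the global step W1 of the proof of Thm. 1.1)

Topic: `Literature/AlgebraicGeometry/Resolution`. Brick W1 of the remaining global step of the proof of the named fact
`KawasakiMacaulayfication` (`Macaulayfication.lean`; census `D/res-D-pv-019/KAWASAKI-GAP-CENSUS.md` of cell res-hironaka).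
Kawasaki 2000, La. 5.3: *"Let `X` be a closed subscheme of `ℙⁿ_A` … there is a homogeneous ideal `𝔞` such that
`𝔞 · 𝒪_{D₊(x_j)} = 𝔞(M_j)` on every standard chart"* — the annihilator ideals of the affine pieces glue to a homogeneous ideal.
We build it WITHOUT sheaf theory, directly from the chart dictionary of `KawasakiCharts.lean`: for a closed immersion
`ι : Z ⟶ ℙⁿ_k`, chart ideals `I j ⊆ Γ(Z, ι⁻¹D₊(x_j))` and a window `T`,

* dehomogenisation is the tree's ring homomorphism `ProjFrac.dehomAway k n j : k[x] → (k[x]_{(x_j)})₀` (`x_j := 1`);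
  private plumbing: `dehomAway_X_self`, `dehomAway_X_pow_mul` (invariance under `G ↦ x_j^N G`), `awayMap_dehomAway_eq` (on the
  overlap ring `G/x_l^m = (x_j/x_l)^m · G/x_j^m`), `Away_mk_ne_zero`, `isLocalizationElem_ne_zero`;
* Kawasaki's `𝔞` = `Ideal.span {G | (∃ m, G ∈ grading k n m) ∧ ∀ j, dehomAway k n j G ∈ chartAnn ι j (I j) T}` is written
  INLINE (no definition); `isHomogeneous_span_annForms` — it is homogeneous; by construction its generators dehomogenise into
  every chart annihilator (the direction consumed pointwise, `KawasakiLocalAnalysis.mem_secantColonAnnihilator_of_mem_extAnn`);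
* `exists_annForm_of_mem_chartAnn` — HOMOGENISATION: if `g ∈ chartAnn ι j (I j) T` then for `N ≫ 0` the form `x_j^N · G`
  (`G/x_j^m = g`) lies in `annForms` — on the other charts by the two-chart compatibility
  `exists_smul_mem_of_mem_extAnn₂` (genuine membership after multiplying by a power of `x_j/x_l`, not a radical statement);
  this needs the chart ideals to be the chart sections of ONE ideal sheaf (hypothesis `hI`), so that the chart modules
  base-change to a common module on the overlap;
* `exists_posHomog_annIdeal_notMem` — consequence: if a prime `𝔭 ∌ x_j` misses a form `G` with `dehomAway j G ∈ chartAnn_j`,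
  then `𝔞` has a positive-degree homogeneous element outside `𝔭`;
* `extAnn_not_le_of_height_le`, `isRegularRing_away_X`, `exists_posHomog_annIdeal_notMem_of_chartPrime` — THE KEY LEMMA in
  chart form: for a prime `𝔮` of height `≤ g` of the regular chart ring receiving the dehomogenised forms of `𝔭`, the window
  `Ioc g N` gives such an element (generic Cohen–Macaulayness: `pd M_𝔮 ≤ ht 𝔮`) — the input of graded prime avoidance
  (`Motives…exists_posHomog_notMem`) for the selection of the forms (W2); the remaining geometric inputs (`hcompat` from ONE
  ideal sheaf; `𝔮` = the chart prime of a minimal prime of the current homogeneous ideal, with its height) are the chart/stalk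
  base-change dictionary (W1c/(b2)) and are taken here as hypotheses.

Everything is proved; no named facts. [cite: Kawasaki2000, La. 5.3 and proof of Thm. 5.1 (p. 2538–2539)]
-/

noncomputable section

open CategoryTheory AlgebraicGeometry TopologicalSpace HomogeneousLocalization MvPolynomial
open Literature.AlgebraicGeometry.Morphisms Literature.AlgebraicGeometry.Morphisms.ProjCech
open Literature.AlgebraicGeometry.Motives Literature.AlgebraicGeometry.Motives.ProjFrac

universe u


attribute [local instance] MvPolynomial.gradedAlgebra
  Literature.AlgebraicGeometry.Motives.ProjBaseChange.algebraBase

namespace Literature.AlgebraicGeometry.Resolution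

variable {k : Type u} [Field k] {n : ℕ} {Z : Scheme.{u}} (ι : Z ⟶ PP k n) [IsClosedImmersion ι]

/-! ## Dehomogenisation on the standard charts (the tree's ring homomorphism `ProjFrac.dehomAway`) -/

/-- `x_j` dehomogenises to `1` on its own chart. [folklore] -/
private theorem dehomAway_X_self (j : Fin (n + 1)) :
    dehomAway k n j (X j : MvPolynomial (Fin (n + 1)) k) = 1 := by
  rw [dehomAway_of_mem j (Segre.X_mem k j), HomogeneousLocalization.ext_iff_val, HomogeneousLocalization.Away.val_mk,
    HomogeneousLocalization.val_one, ← Localization.mk_self (⟨X j ^ 1, ⟨1, rfl⟩⟩ : Submonoid.powers (X j : MvPolynomial (Fin (n + 1)) k))]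
  simp

/-- `x_j^N · G` dehomogenises like `G` on the chart `j`. [folklore] -/
private theorem dehomAway_X_pow_mul (j : Fin (n + 1)) (N : ℕ) (G : MvPolynomial (Fin (n + 1)) k) :
    dehomAway k n j (X j ^ N * G) = dehomAway k n j G := by
  rw [map_mul, map_pow, dehomAway_X_self, one_pow, one_mul]

/-! ## The two dehomogenisations of a form on an overlap `D₊(x_j x_l)` -/

/-- On the overlap ring `(k[x]_{(x_j x_l)})₀` the `l`-dehomogenisation of a form of degree `m` is the `j`-dehomogenisation
times the `m`-th power of the unit `x_j/x_l` (image of `Away.isLocalizationElem`): `G/x_l^m = (x_j/x_l)^m · G/x_j^m`.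
Here `B_j → C` is `awayMap` along `X j * X l = X j * X l` and `B_l → C` is `awayMap` along `X j * X l = X l * X j`. [folklore] -/
private theorem awayMap_dehomAway_eq (j l : Fin (n + 1)) {m : ℕ} {G : MvPolynomial (Fin (n + 1)) k} (hG : G ∈ grading k n m) :
    awayMap (grading k n) (Segre.X_mem k j) (mul_comm (X j) (X l) : (X j * X l : MvPolynomial (Fin (n + 1)) k) = X l * X j)
        (dehomAway k n l G) =
      awayMap (grading k n) (Segre.X_mem k j) (mul_comm (X j) (X l) : (X j * X l : MvPolynomial (Fin (n + 1)) k) = X l * X j)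
          (Away.isLocalizationElem (Segre.X_mem k l) (Segre.X_mem k j)) ^ m *
        awayMap (grading k n) (Segre.X_mem k l) (rfl : (X j * X l : MvPolynomial (Fin (n + 1)) k) = X j * X l)
          (dehomAway k n j G) := by
  rw [dehomAway_of_mem l hG, dehomAway_of_mem j hG, HomogeneousLocalization.ext_iff_val, HomogeneousLocalization.val_mul,
    HomogeneousLocalization.val_pow]
  simp only [Away.isLocalizationElem, HomogeneousLocalization.awayMap_mk, HomogeneousLocalization.Away.val_mk,
    Localization.mk_pow, Localization.mk_mul]
  rw [Localization.mk_eq_mk_iff, Localization.r_iff_exists]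
  refine ⟨1, ?_⟩
  simp only [OneMemClass.coe_one, one_mul, Submonoid.coe_mul, SubmonoidClass.coe_pow]
  ring

/-! ## The homogeneous annihilator ideal -/

/-- **Kawasaki's homogeneous annihilator ideal `𝔞`** of a family of chart ideals `I` (window `T`) is the span of the forms all
of whose dehomogenisations lie in the chart annihilator ideals; it is written INLINE as
`Ideal.span {G | (∃ m, G ∈ grading k n m) ∧ ∀ j, dehomAway k n j G ∈ chartAnn ι j (I j) T}` (no definition is introduced).
This lemma records that it is a homogeneous ideal, so that consumers may package it as a `HomogeneousIdeal (grading k n)`.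
[cite: Kawasaki2000, La. 5.3] -/
theorem isHomogeneous_span_annForms (I : ∀ j : Fin (n + 1), Ideal Γ(Z, ZH ι (X j))) (T : Finset ℕ) :
    (Ideal.span {G : MvPolynomial (Fin (n + 1)) k | (∃ m : ℕ, G ∈ grading k n m) ∧ ∀ j : Fin (n + 1), dehomAway k n j G ∈ chartAnn ι j (I j) T}).IsHomogeneous (grading k n) :=
  Ideal.homogeneous_span _ _ (by
    rintro G ⟨⟨m, hG⟩, -⟩
    exact ⟨m, hG⟩)

/-! ## W1c (not in this file): `hcompat` from ONE ideal sheaf — the chart/stalk base-change dictionary (b2)(i). -/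


/-! ## W1b — homogenisation through the two-chart compatibility -/

/-- A degree-zero fraction with non-zero numerator is non-zero (the ambient polynomial ring is a domain). [folklore] -/
private theorem Away_mk_ne_zero {f : MvPolynomial (Fin (n + 1)) k} {d : ℕ} (hf : f ∈ grading k n d) (hf0 : f ≠ 0) (e : ℕ)
    (a : MvPolynomial (Fin (n + 1)) k) (ha : a ∈ grading k n (e • d)) (ha0 : a ≠ 0) :
    HomogeneousLocalization.Away.mk (grading k n) hf e a ha ≠ 0 := by
  intro h
  rw [HomogeneousLocalization.ext_iff_val, HomogeneousLocalization.Away.val_mk, HomogeneousLocalization.val_zero,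
    ← Localization.mk_zero (⟨f ^ e, ⟨e, rfl⟩⟩ : Submonoid.powers f), Localization.mk_eq_mk_iff,
    Localization.r_iff_exists] at h
  obtain ⟨⟨u, ⟨i, rfl⟩⟩, hu⟩ := h
  simp only [mul_zero, mul_eq_zero, pow_eq_zero_iff', ne_eq] at hu
  rcases hu with ⟨h1, -⟩ | ⟨h1, -⟩ | h2
  · exact hf0 h1
  · exact hf0 h1
  · exact ha0 h2

/-- The gluing element `x_j / x_l ∈ (k[x]_{(x_l)})₀` is non-zero. [folklore] -/
private theorem isLocalizationElem_ne_zero (j l : Fin (n + 1)) :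
    (Away.isLocalizationElem (Segre.X_mem k l) (Segre.X_mem k j) :
      Away (grading k n) (X l : MvPolynomial (Fin (n + 1)) k)) ≠ 0 :=
  Away_mk_ne_zero (Segre.X_mem k l) (X_ne_zero l) 1 _ _ (by simp [X_ne_zero j])

/-- **Homogenisation** (Kawasaki 2000, proof of La. 5.3): if the chart annihilator ideals agree on every overlap
(`hcompat`, the conclusion of `extAnn_map_eq_of_isLocalization₂`), then for a form `G` with `dehomAway j G ∈ chartAnn_j` the form
`x_j^N · G` lies in `annForms` for `N ≫ 0` — on the chart `l` one clears the denominator `(x_j/x_l)^e` given by the localisation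
`(k[x]_{(x_j x_l)})₀ = (k[x]_{(x_l)})₀[x_l/x_j]` and multiplies back (GENUINE membership, no radicals). [cite: Kawasaki2000, La. 5.3] -/
theorem exists_annForm_of_mem_chartAnn (I : ∀ j : Fin (n + 1), Ideal Γ(Z, ZH ι (X j))) (T : Finset ℕ)
    (hcompat : ∀ j l : Fin (n + 1),
      (chartAnn ι j (I j) T).map (awayMap (grading k n) (Segre.X_mem k l)
          (rfl : (X j * X l : MvPolynomial (Fin (n + 1)) k) = X j * X l)) =
      (chartAnn ι l (I l) T).map (awayMap (grading k n) (Segre.X_mem k j)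
          (mul_comm (X j) (X l) : (X j * X l : MvPolynomial (Fin (n + 1)) k) = X l * X j)))
    {j : Fin (n + 1)} {m : ℕ} {G : MvPolynomial (Fin (n + 1)) k} (hG : G ∈ grading k n m)
    (hg : dehomAway k n j G ∈ chartAnn ι j (I j) T) :
    ∃ N : ℕ, X j ^ N * G ∈ {G : MvPolynomial (Fin (n + 1)) k | (∃ m : ℕ, G ∈ grading k n m) ∧ ∀ j : Fin (n + 1), dehomAway k n j G ∈ chartAnn ι j (I j) T} := by
  classical
  -- on each chart `l`, an exponent `e l` clearing the denominator
  have key : ∀ l : Fin (n + 1), ∃ e : ℕ, ∀ e' : ℕ, e ≤ e' + m →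
      dehomAway k n l (X j ^ e' * G) ∈ chartAnn ι l (I l) T := by
    intro l
    let ψ := awayMap (grading k n) (Segre.X_mem k j)
      (mul_comm (X j) (X l) : (X j * X l : MvPolynomial (Fin (n + 1)) k) = X l * X j)
    letI := ψ.toAlgebra
    haveI hloc : IsLocalization.Away (Away.isLocalizationElem (Segre.X_mem k l) (Segre.X_mem k j))
        (Away (grading k n) (X j * X l : MvPolynomial (Fin (n + 1)) k)) :=
      Away.isLocalization_mul (Segre.X_mem k l) (Segre.X_mem k j) _ one_ne_zero
    set t := Away.isLocalizationElem (Segre.X_mem k l) (Segre.X_mem k j) with ht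
    have hmem : awayMap (grading k n) (Segre.X_mem k l) (rfl : (X j * X l : MvPolynomial (Fin (n + 1)) k) = X j * X l)
        (dehomAway k n j G) ∈ (chartAnn ι l (I l) T).map (algebraMap _ _) := by
      rw [RingHom.algebraMap_toAlgebra, ← hcompat j l]
      exact Ideal.mem_map_of_mem _ hg
    rw [IsLocalization.mem_map_algebraMap_iff (Submonoid.powers t)] at hmem
    obtain ⟨⟨⟨a, ha⟩, ⟨s, ⟨e, rfl⟩⟩⟩, hz⟩ := hmem
    refine ⟨e, fun e' hle => ?_⟩
    have hinj : Function.Injective (algebraMap (Away (grading k n) (X l : MvPolynomial (Fin (n + 1)) k))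
        (Away (grading k n) (X j * X l : MvPolynomial (Fin (n + 1)) k))) :=
      IsLocalization.injective (M := Submonoid.powers t) _
        (powers_le_nonZeroDivisors_of_noZeroDivisors (isLocalizationElem_ne_zero j l))
    have hG' : X j ^ e' * G ∈ grading k n (e' + m) := by
      simpa using SetLike.mul_mem_graded (SetLike.pow_mem_graded e' (Segre.X_mem k j)) hG
    have hcalc : algebraMap _ (Away (grading k n) (X j * X l : MvPolynomial (Fin (n + 1)) k))
        (dehomAway k n l (X j ^ e' * G)) = algebraMap _ _ (t ^ (e' + m - e) * a) := by
      rw [RingHom.algebraMap_toAlgebra]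
      change ψ _ = ψ _
      have h1 := awayMap_dehomAway_eq (k := k) j l hG'
      rw [dehomAway_X_pow_mul] at h1
      change ψ (dehomAway k n l (X j ^ e' * G)) = ψ t ^ (e' + m) * _ at h1
      rw [h1, map_mul, map_pow]
      have hz' : awayMap (grading k n) (Segre.X_mem k l) rfl (dehomAway k n j G) * ψ t ^ e = ψ a := by
        have := hz
        simp only [RingHom.algebraMap_toAlgebra, map_pow] at this
        exact this
      calc ψ t ^ (e' + m) * awayMap (grading k n) (Segre.X_mem k l) rfl (dehomAway k n j G)
          = ψ t ^ (e' + m - e) * (awayMap (grading k n) (Segre.X_mem k l) rfl (dehomAway k n j G) * ψ t ^ e) := by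
            rw [mul_comm (awayMap (grading k n) (Segre.X_mem k l) rfl (dehomAway k n j G)) (ψ t ^ e), ← mul_assoc,
              ← pow_add, Nat.sub_add_cancel hle]
        _ = ψ t ^ (e' + m - e) * ψ a := by rw [hz']
    have : dehomAway k n l (X j ^ e' * G) = t ^ (e' + m - e) * a := hinj hcalc
    rw [this]
    exact Ideal.mul_mem_left _ _ ha
  choose e he using key
  refine ⟨Finset.univ.sup e + m, ⟨⟨Finset.univ.sup e + m + m, ?_⟩, fun l => ?_⟩⟩
  · simpa [add_assoc] using SetLike.mul_mem_graded (SetLike.pow_mem_graded (Finset.univ.sup e + m) (Segre.X_mem k j)) hG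
  · exact he l _ (by have := Finset.le_sup (f := e) (Finset.mem_univ l); omega)

/-- **The input of graded prime avoidance** (W1 ⇒ W2): if a homogeneous-prime-like ideal `𝔭` (any prime) misses `x_j` and
some form `G ∉ 𝔭` dehomogenises on the chart `j` into the chart annihilator, then Kawasaki's homogeneous ideal `𝔞 = annIdeal`
has a homogeneous element of positive degree outside `𝔭` — namely `x_j^{N+1} · G`. [cite: Kawasaki2000, La. 5.3] -/
theorem exists_posHomog_annIdeal_notMem (I : ∀ j : Fin (n + 1), Ideal Γ(Z, ZH ι (X j))) (T : Finset ℕ)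
    (hcompat : ∀ j l : Fin (n + 1),
      (chartAnn ι j (I j) T).map (awayMap (grading k n) (Segre.X_mem k l)
          (rfl : (X j * X l : MvPolynomial (Fin (n + 1)) k) = X j * X l)) =
      (chartAnn ι l (I l) T).map (awayMap (grading k n) (Segre.X_mem k j)
          (mul_comm (X j) (X l) : (X j * X l : MvPolynomial (Fin (n + 1)) k) = X l * X j)))
    {𝔭 : Ideal (MvPolynomial (Fin (n + 1)) k)} [𝔭.IsPrime] {j : Fin (n + 1)}
    (hj : (X j : MvPolynomial (Fin (n + 1)) k) ∉ 𝔭) {m : ℕ} {G : MvPolynomial (Fin (n + 1)) k}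
    (hG : G ∈ grading k n m) (hG𝔭 : G ∉ 𝔭) (hg : dehomAway k n j G ∈ chartAnn ι j (I j) T) :
    ∃ a, Literature.AlgebraicGeometry.Motives.GradedPrimeAvoidance.PosHomog (grading k n)
      (Ideal.span {G : MvPolynomial (Fin (n + 1)) k | (∃ m : ℕ, G ∈ grading k n m) ∧ ∀ j : Fin (n + 1), dehomAway k n j G ∈ chartAnn ι j (I j) T}) a ∧ a ∉ 𝔭 := by
  obtain ⟨N, hN⟩ := exists_annForm_of_mem_chartAnn ι I T hcompat hG hg
  refine ⟨X j ^ (N + 1) * G, ⟨N + 1 + m, by omega, ?_, ?_⟩, ?_⟩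
  · simpa [add_assoc] using SetLike.mul_mem_graded (SetLike.pow_mem_graded (N + 1) (Segre.X_mem k j)) hG
  · have h1 : (X j ^ (N + 1) * G : MvPolynomial (Fin (n + 1)) k) = X j * (X j ^ N * G) := by ring
    rw [h1]
    exact Ideal.mul_mem_left _ _ (Ideal.subset_span hN)
  · intro h
    rcases ‹𝔭.IsPrime›.mem_or_mem h with h1 | h2
    · exact hj (‹𝔭.IsPrime›.mem_of_pow_mem _ h1)
    · exact hG𝔭 h2


/-! ## W1d — the chart annihilator avoids the primes of small height (generic Cohen–Macaulayness on a chart) -/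

/-- **`extAnn` avoids the primes of height `≤ g` at which the ring is regular** — the form of
`prod_annihilator_EMod_not_le_of_height_le` (there for a regular LOCAL ambient ring) for a Noetherian domain `B` and a prime
`𝔮` with `B_𝔮` regular (e.g. every prime of a chart ring `(k[x]_{(x_j)})₀ ≅ k[y]`): if `ht 𝔮 ≤ g` then
`extAnn B M (Ioc g N) ⊄ 𝔮`, because `pd_{B_𝔮} M_𝔮 ≤ dim B_𝔮 = ht 𝔮 ≤ g` makes the localised syzygies from degree `g` on
projective (`FreeResolution.annihilator_EMod_not_le`). [cite: BrunsHerzog1998, Thm. 8.1.1; Kawasaki2000, La. 2.4 (1)] -/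
theorem extAnn_not_le_of_height_le {B : Type u} [CommRing B] [IsNoetherianRing B] [IsDomain B]
    {M : Type u} [AddCommGroup M] [Module B M] [Module.Finite B M]
    (𝔮 : Ideal B) [𝔮.IsPrime] [IsRegularLocalRing (Localization.AtPrime 𝔮)] {g : ℕ} (N : ℕ) (h𝔮 : 𝔮.height ≤ g) :
    ¬ extAnn B M (Finset.Ioc g N) ≤ 𝔮 := by
  intro hle
  rw [extAnn] at hle
  obtain ⟨q, hq, hq'⟩ := (Ideal.IsPrime.prod_le inferInstance).mp hle
  rw [Finset.mem_Ioc] at hq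
  obtain ⟨q', rfl⟩ : ∃ q', q = q' + 1 := ⟨q - 1, by omega⟩
  refine (FreeResolution.ofNoetherian (R := B) M).annihilator_EMod_not_le 𝔮 q' ?_ hq'
  obtain ⟨xs, hxreg, hxspan, hxlen⟩ :=
    exists_isRegular_ofList_eq_maximalIdeal (R := Localization.AtPrime 𝔮)
  have hpd := hasProjectiveDimensionLE_length_of_isWeaklyRegular hxreg.toIsWeaklyRegular hxspan
    (ModuleCat.of (Localization.AtPrime 𝔮) (LocalizedModule 𝔮.primeCompl M))
  rw [IsLocalization.AtPrime.ringKrullDim_eq_height 𝔮 (Localization.AtPrime 𝔮)] at hxlen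
  have hlen : (xs.length : ℕ∞) = 𝔮.height := by exact_mod_cast hxlen
  have hle' : xs.length ≤ q' := by
    have : (xs.length : ℕ∞) ≤ g := hlen ▸ h𝔮
    have : xs.length ≤ g := by exact_mod_cast this
    omega
  haveI := hpd
  haveI : HasProjectiveDimensionLE
      (ModuleCat.of (Localization.AtPrime 𝔮) (LocalizedModule 𝔮.primeCompl M)) q' :=
    hasProjectiveDimensionLT_of_ge _ (xs.length + 1) (q' + 1) (by omega)
  exact ((FreeResolution.ofNoetherian (R := B) M).localize 𝔮).projective_syzygyObj_of_hasProjectiveDimensionLE this q' le_rfl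


/-- The chart rings `(k[x]_{(x_j)})₀ ≅ k[y₁,…,yₙ]` are regular rings (a polynomial ring over a regular ring — here a
field — is regular). [cite: Matsumura1987, Thm. 19.5] -/
theorem isRegularRing_away_X (j : Fin (n + 1)) :
    IsRegularRing (Away (grading k n) (X j : MvPolynomial (Fin (n + 1)) k)) :=
  IsRegularRing.of_ringEquiv (ProjectiveSpace.chartAlgEquiv k j).symm.toRingEquiv

/-- **THE KEY LEMMA OF W1, chart form** (input of graded prime avoidance in the selection of Kawasaki's forms): let the chart
annihilators be compatible on overlaps (`hcompat`), `𝔭` a prime of `k[x]` missing `x_j`, and `𝔮` a prime of the chart ring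
`(k[x]_{(x_j)})₀` of height `≤ g` receiving the dehomogenisations of the forms of `𝔭` (for the minimal primes of the current
homogeneous ideal: `𝔮` = the dehomogenised prime, `g = n − dim`); then for the window `Ioc g N` Kawasaki's homogeneous ideal
`annIdeal` has a positive-degree homogeneous element outside `𝔭`. Proof: `extAnn_not_le_of_height_le` on the chart gives a
fraction `a/x_j^m ∈ chartAnn_j ∖ 𝔮`, so the form `a ∉ 𝔭`, and `exists_posHomog_annIdeal_notMem` homogenises it.
[cite: Kawasaki2000, La. 2.4 (1), La. 5.3] -/
theorem exists_posHomog_annIdeal_notMem_of_chartPrime (I : ∀ j : Fin (n + 1), Ideal Γ(Z, ZH ι (X j))) {g N : ℕ}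
    (hcompat : ∀ j l : Fin (n + 1),
      (chartAnn ι j (I j) (Finset.Ioc g N)).map (awayMap (grading k n) (Segre.X_mem k l)
          (rfl : (X j * X l : MvPolynomial (Fin (n + 1)) k) = X j * X l)) =
      (chartAnn ι l (I l) (Finset.Ioc g N)).map (awayMap (grading k n) (Segre.X_mem k j)
          (mul_comm (X j) (X l) : (X j * X l : MvPolynomial (Fin (n + 1)) k) = X l * X j)))
    {𝔭 : Ideal (MvPolynomial (Fin (n + 1)) k)} [𝔭.IsPrime] {j : Fin (n + 1)}
    (hj : (X j : MvPolynomial (Fin (n + 1)) k) ∉ 𝔭)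
    (𝔮 : Ideal (Away (grading k n) (X j : MvPolynomial (Fin (n + 1)) k))) [𝔮.IsPrime] (h𝔮 : 𝔮.height ≤ g)
    (hcorr : ∀ (m : ℕ) (G : MvPolynomial (Fin (n + 1)) k), G ∈ grading k n m → G ∈ 𝔭 → dehomAway k n j G ∈ 𝔮) :
    ∃ a, Literature.AlgebraicGeometry.Motives.GradedPrimeAvoidance.PosHomog (grading k n)
      (Ideal.span {G : MvPolynomial (Fin (n + 1)) k | (∃ m : ℕ, G ∈ grading k n m) ∧ ∀ j : Fin (n + 1), dehomAway k n j G ∈ chartAnn ι j (I j) (Finset.Ioc g N)}) a ∧ a ∉ 𝔭 := by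
  haveI := isRegularRing_away_X (k := k) (n := n) j
  have hnot : ¬ chartAnn ι j (I j) (Finset.Ioc g N) ≤ 𝔮 :=
    extAnn_not_le_of_height_le (M := ChartQuot ι (X j) (I j)) 𝔮 N h𝔮
  obtain ⟨g', hg', hg'𝔮⟩ := SetLike.not_le_iff_exists.mp hnot
  obtain ⟨m, a, ha, rfl⟩ := HomogeneousLocalization.Away.mk_surjective (grading k n) (Segre.X_mem k j) g'
  have ha' : a ∈ grading k n m := by simpa using ha
  have hdeh : dehomAway k n j a = HomogeneousLocalization.Away.mk (grading k n) (Segre.X_mem k j) m a ha :=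
    dehomAway_of_mem j ha'
  have ha𝔭 : a ∉ 𝔭 := fun h => hg'𝔮 (hdeh ▸ hcorr m a ha' h)
  exact exists_posHomog_annIdeal_notMem ι I (Finset.Ioc g N) hcompat hj ha' ha𝔭 (hdeh ▸ hg')

end Literature.AlgebraicGeometry.Resolution

end
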